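import Summits.Ventures.PercRepro.Night2FatDDComb2

/-!
# night-2: the doubly degenerate regime — the line conditions in mode form

Each line condition of the unloaded family is determined by a MODE `t ∈ {0, 1, 2}` computed from the number `n` of
basis points on the line and its class property: `t = 2` (two basis points, class) asks for two points of `Y` off the
line, `t = 1` (two basis points non-class, or one basis point class) asks `Y ⊄ line`, `t = 0` nothing.
**`card_filter_not_mode_cond_le`** bounds the complement, **`choose_le_card_filter_three_modes`** is the union bound
for the three lines, **`line_cond_of_mode_cond`** recovers the family condition of `dload_eq_zero_of_dd_family`, and
**`mode_bound_eq`** identifies the bound with the `(n, cls)`-form used by the numerics `Night2FatDDNum*`.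
Paper `proofs/NIGHT-2-g35.md` §7.
-/

namespace PercRepro.Shadow

variable {α : Type*} [DecidableEq α]

/-- **The complement of a line condition in mode form** (`t = 2`: two points off the line; `t = 1`: not inside the
line; otherwise nothing). -/
theorem card_filter_not_mode_cond_le (W C : Finset α) (k t : ℕ) :
    ((W.powersetCard k).filter (fun Y => ¬ ((t = 2 → 2 ≤ (Y \ C).card) ∧ (t = 1 → ¬ Y ⊆ C)))).card ≤
      if t = 2 then (W.filter (fun e => e ∈ C)).card.choose k +
          (W.card - (W.filter (fun e => e ∈ C)).card) * (W.filter (fun e => e ∈ C)).card.choose (k - 1)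
        else if t = 1 then (W.filter (fun e => e ∈ C)).card.choose k else 0 := by
  set S := W.filter (fun e => e ∈ C) with hS
  have hSW : S ⊆ W := Finset.filter_subset _ _
  have hsub : ∀ Y ∈ W.powersetCard k, (Y ⊆ C ↔ Y ⊆ S) := by
    intro Y hY
    have hYW : Y ⊆ W := (Finset.mem_powersetCard.1 hY).1
    constructor
    · intro h e he; exact Finset.mem_filter.2 ⟨hYW he, h he⟩
    · intro h e he; exact (Finset.mem_filter.1 (h he)).2
  have hsd : ∀ Y ∈ W.powersetCard k, Y \ C = Y \ S := by
    intro Y hY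
    have hYW : Y ⊆ W := (Finset.mem_powersetCard.1 hY).1
    ext e
    rw [Finset.mem_sdiff, Finset.mem_sdiff, hS, Finset.mem_filter]
    constructor
    · rintro ⟨he, heC⟩; exact ⟨he, fun h => heC h.2⟩
    · rintro ⟨he, heS⟩; exact ⟨he, fun h => heS ⟨hYW he, h⟩⟩
  by_cases h2 : t = 2
  · rw [if_pos h2]
    refine le_trans (Finset.card_le_card ?_) (card_filter_sdiff_le_one_le W S hSW k)
    intro Y hY
    rw [Finset.mem_filter] at hY ⊢
    refine ⟨hY.1, ?_⟩
    rw [← hsd Y hY.1]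
    by_contra hY1
    exact hY.2 ⟨fun _ => by omega, fun h1 => absurd h1 (by omega)⟩
  rw [if_neg h2]
  by_cases h1 : t = 1
  · rw [if_pos h1]
    refine le_of_le_of_eq (Finset.card_le_card ?_) (card_filter_subset_powersetCard W S hSW k)
    intro Y hY
    rw [Finset.mem_filter] at hY ⊢
    refine ⟨hY.1, ?_⟩
    by_contra hYS
    exact hY.2 ⟨fun h => absurd h h2, fun _ => fun h => hYS ((hsub Y hY.1).1 h)⟩
  · rw [if_neg h1]
    have : (W.powersetCard k).filter (fun Y => ¬ ((t = 2 → 2 ≤ (Y \ C).card) ∧ (t = 1 → ¬ Y ⊆ C))) = ∅ := by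
      rw [Finset.filter_eq_empty_iff]
      intro Y _ h
      exact h ⟨fun h' => absurd h' h2, fun h' => absurd h' h1⟩
    rw [this, Finset.card_empty]

/-- **The union bound for the three line conditions in mode form.** -/
theorem choose_le_card_filter_three_modes (W C₁ C₂ C₃ : Finset α) (k t₁ t₂ t₃ : ℕ) :
    W.card.choose k ≤ ((W.powersetCard k).filter (fun Y =>
        ((t₁ = 2 → 2 ≤ (Y \ C₁).card) ∧ (t₁ = 1 → ¬ Y ⊆ C₁)) ∧
        ((t₂ = 2 → 2 ≤ (Y \ C₂).card) ∧ (t₂ = 1 → ¬ Y ⊆ C₂)) ∧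
        ((t₃ = 2 → 2 ≤ (Y \ C₃).card) ∧ (t₃ = 1 → ¬ Y ⊆ C₃)))).card +
      (if t₁ = 2 then (W.filter (fun e => e ∈ C₁)).card.choose k +
          (W.card - (W.filter (fun e => e ∈ C₁)).card) * (W.filter (fun e => e ∈ C₁)).card.choose (k - 1)
        else if t₁ = 1 then (W.filter (fun e => e ∈ C₁)).card.choose k else 0) +
      (if t₂ = 2 then (W.filter (fun e => e ∈ C₂)).card.choose k +
          (W.card - (W.filter (fun e => e ∈ C₂)).card) * (W.filter (fun e => e ∈ C₂)).card.choose (k - 1)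
        else if t₂ = 1 then (W.filter (fun e => e ∈ C₂)).card.choose k else 0) +
      (if t₃ = 2 then (W.filter (fun e => e ∈ C₃)).card.choose k +
          (W.card - (W.filter (fun e => e ∈ C₃)).card) * (W.filter (fun e => e ∈ C₃)).card.choose (k - 1)
        else if t₃ = 1 then (W.filter (fun e => e ∈ C₃)).card.choose k else 0) := by
  have h0 := choose_le_card_filter_three W k
    (fun Y => (t₁ = 2 → 2 ≤ (Y \ C₁).card) ∧ (t₁ = 1 → ¬ Y ⊆ C₁))
    (fun Y => (t₂ = 2 → 2 ≤ (Y \ C₂).card) ∧ (t₂ = 1 → ¬ Y ⊆ C₂))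
    (fun Y => (t₃ = 2 → 2 ≤ (Y \ C₃).card) ∧ (t₃ = 1 → ¬ Y ⊆ C₃))
  have h1 := card_filter_not_mode_cond_le W C₁ k t₁
  have h2 := card_filter_not_mode_cond_le W C₂ k t₂
  have h3 := card_filter_not_mode_cond_le W C₃ k t₃
  omega

/-- **From the mode condition to the line condition of the unloaded family**: with
`t = if cls then (if 2 ≤ n then 2 else if n = 1 then 1 else 0) else (if 2 ≤ n then 1 else 0)`. -/
theorem line_cond_of_mode_cond {C Y : Finset α} {n t : ℕ} {cls : Prop} [Decidable cls]
    (ht : t = if cls then (if 2 ≤ n then 2 else if n = 1 then 1 else 0) else (if 2 ≤ n then 1 else 0))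
    (h : (t = 2 → 2 ≤ (Y \ C).card) ∧ (t = 1 → ¬ Y ⊆ C)) :
    (2 ≤ n → cls → 2 ≤ (Y \ C).card) ∧ (2 ≤ n → ¬ cls → ¬ Y ⊆ C) ∧ (n = 1 → cls → ¬ Y ⊆ C) := by
  refine ⟨fun hn hc => h.1 ?_, fun hn hc => h.2 ?_, fun hn hc => h.2 ?_⟩
  · rw [ht, if_pos hc, if_pos hn]
  · rw [ht, if_neg hc, if_pos hn]
  · rw [ht, if_pos hc, if_neg (by omega), if_pos hn]

/-- **The mode-form bound equals the `(n, cls)`-form bound** of the numerics. -/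
theorem mode_bound_eq {n t m s k : ℕ} {cls : Prop} [Decidable cls]
    (ht : t = if cls then (if 2 ≤ n then 2 else if n = 1 then 1 else 0) else (if 2 ≤ n then 1 else 0)) :
    (if t = 2 then s.choose k + (m - s) * s.choose (k - 1) else if t = 1 then s.choose k else 0) =
      if cls then (if 1 ≤ n then s.choose k else 0) + (if 2 ≤ n then (m - s) * s.choose (k - 1) else 0)
        else (if 2 ≤ n then s.choose k else 0) := by
  by_cases hc : cls
  · rcases Nat.lt_or_ge n 1 with h0 | h1
    · have hn1 : ¬ 1 ≤ n := by omega
      have hn2 : ¬ 2 ≤ n := by omega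
      have hn1' : ¬ n = 1 := by omega
      have : t = 0 := by rw [ht, if_pos hc, if_neg hn2, if_neg hn1']
      subst this
      simp [hc, hn1, hn2]
    rcases Nat.lt_or_ge n 2 with h1' | h2
    · have hn2 : ¬ 2 ≤ n := by omega
      have hn1' : n = 1 := by omega
      have : t = 1 := by rw [ht, if_pos hc, if_neg hn2, if_pos hn1']
      subst this
      simp [hc, h1, hn2]
    · have : t = 2 := by rw [ht, if_pos hc, if_pos h2]
      subst this
      simp [hc, h1, h2]
  · rcases Nat.lt_or_ge n 2 with h1 | h2
    · have hn2 : ¬ 2 ≤ n := by omega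
      have : t = 0 := by rw [ht, if_neg hc, if_neg hn2]
      subst this
      simp [hc, hn2]
    · have : t = 1 := by rw [ht, if_neg hc, if_pos h2]
      subst this
      simp [hc, h2]

end PercRepro.Shadow
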